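import Mathlib.Combinatorics.SetFamily.Compression.UV
import Mathlib.Data.Finset.Sups
import Mathlib.Data.Fintype.Card

/-!
# `NoHeavyLowerTail` (crux stmt-CriticalPhenomena-4575), lane prim-ineq-gen-4 (gen 20): the anti-band functional is monotone
# under OPPOSITE UV-compressions (the reduction of (AB) to shifted pairs)

Support file (`--supports stmt-CriticalPhenomena-4575`; memo `run/shared/lean/prim/prim-ineq-gen-4/FINDING-SHIFTING-AB-g20.md` §1).
Pure finite combinatorics, no definitions, no `sorry`, standard axioms.

CONTEXT.  The anti-band inequality (AB_l) for two up-sets `W, V` of finsets of `β` (`y = card β`, `l ≤ y/2`) reads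
  `#{s ∈ W ∩ V | outer s} ≥ #{s ∈ W ∩ Vᶜˢ | outer s}`,  `outer s := #s < l ∨ #sᶜ < l`
(gen 19 conjecture "odd Harris on Hamming balls"; Lemma J = the case `l = 2`).  Gen 20 reduces it to COMPRESSED pairs: compressing `W`
along `(u,v)` and `V` along `(v,u)` (opposite directions, `u ⊓ v = ⊥`, `#u = #v`) never increases `#{W ∩ V, outer} − #{W ∩ Vᶜˢ, outer}`.
With `u = {i}`, `v = {j}` these are the classical `ij`-shifts (which preserve up-sets), so (AB_l) holds for all pairs of up-sets iff it holds
for left-shifted `W` against right-shifted `V`; that was then verified exactly for all `y ≤ 9` (memo §2).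

THIS FILE (all proofs are explicit injections / bijections):
* `card_inter_le_card_compression_inter`        : `#(s ∩ t) ≤ #(𝓒 u v s ∩ 𝓒 u v t)`   (equal compressions gain common members),
* `card_compression_inter_compression_swap_le`   : `#(𝓒 u v s ∩ 𝓒 v u t) ≤ #(s ∩ t)`   (opposite compressions lose common members),
* `compl_compress`, `compls_compression_swap`    : complements turn a `(v,u)`-compression into a `(u,v)`-compression,
* `compression_filter`                           : compression commutes with an invariant filter,
* `antiBand_compression_swap_le`                 : the anti-band functional does not increase under opposite compressions.
-/

namespace Summit.CriticalPhenomena.PercolationContinuityZ3.Theorems.AntiBandShift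

open Finset
open scoped FinsetFamily

section GBA

variable {α : Type*} [GeneralizedBooleanAlgebra α] [DecidableRel (@Disjoint α _ _)] [DecidableLE α]
  [DecidableEq α] {u v a : α} {s t : Finset α}

omit [DecidableEq α] in
/-- If compressing `a` along `u, v` moves it, then `u` is disjoint from `a` and `v ≤ a`. [folklore] -/
theorem disjoint_and_le_of_compress_ne (h : UV.compress u v a ≠ a) : Disjoint u a ∧ v ≤ a := by
  unfold UV.compress at h
  split_ifs at h with h'
  · exact h'
  · exact (h rfl).elim

/-- A member of a family that survives in the `u,v`-compression has its own compression in the family. [folklore] -/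
theorem compress_mem_of_mem_of_mem_compression (ha : a ∈ s) (hac : a ∈ 𝓒 u v s) :
    UV.compress u v a ∈ s := by
  rw [UV.mem_compression] at hac
  rcases hac with ⟨_, h⟩ | ⟨hns, _⟩
  · exact h
  · exact (hns ha).elim

/-- Compressing two families along the SAME pair `u, v` does not decrease the number of common members
(injection `a ↦ a` if the compression of `a` stays in both families, else `a ↦ compress u v a`). [folklore] -/
theorem card_inter_le_card_compression_inter (u v : α) (s t : Finset α) :
    #(s ∩ t) ≤ #(𝓒 u v s ∩ 𝓒 u v t) := by
  classical
  let f : α → α := fun a =>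
    if UV.compress u v a ∈ s ∧ UV.compress u v a ∈ t then a else UV.compress u v a
  have hf : ∀ a, a ∈ s ∩ t → f a ∈ 𝓒 u v s ∩ 𝓒 u v t := by
    intro a ha
    rw [mem_inter] at ha
    simp only [f, mem_inter]
    split_ifs with h
    · exact ⟨UV.mem_compression.2 (Or.inl ⟨ha.1, h.1⟩), UV.mem_compression.2 (Or.inl ⟨ha.2, h.2⟩)⟩
    · exact ⟨UV.compress_mem_compression ha.1, UV.compress_mem_compression ha.2⟩
  refine card_le_card_of_injOn f (fun a ha => mem_coe.2 (hf a (mem_coe.1 ha))) ?_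
  intro a₁ ha₁ a₂ ha₂ hf12
  rw [mem_coe, mem_inter] at ha₁ ha₂
  simp only [f] at hf12
  by_cases h₁ : UV.compress u v a₁ ∈ s ∧ UV.compress u v a₁ ∈ t
  · by_cases h₂ : UV.compress u v a₂ ∈ s ∧ UV.compress u v a₂ ∈ t
    · rwa [if_pos h₁, if_pos h₂] at hf12
    · rw [if_pos h₁, if_neg h₂] at hf12
      exact (h₂ (hf12 ▸ ⟨ha₁.1, ha₁.2⟩)).elim
  · by_cases h₂ : UV.compress u v a₂ ∈ s ∧ UV.compress u v a₂ ∈ t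
    · rw [if_neg h₁, if_pos h₂] at hf12
      exact (h₁ (hf12.symm ▸ ⟨ha₂.1, ha₂.2⟩)).elim
    · rw [if_neg h₁, if_neg h₂] at hf12
      have hm₁ : UV.compress u v a₁ ≠ a₁ := fun he => h₁ (by rw [he]; exact ⟨ha₁.1, ha₁.2⟩)
      have hm₂ : UV.compress u v a₂ ≠ a₂ := fun he => h₂ (by rw [he]; exact ⟨ha₂.1, ha₂.2⟩)
      obtain ⟨hd₁, hl₁⟩ := disjoint_and_le_of_compress_ne hm₁
      obtain ⟨hd₂, hl₂⟩ := disjoint_and_le_of_compress_ne hm₂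
      rw [UV.compress_of_disjoint_of_le hd₁ hl₁, UV.compress_of_disjoint_of_le hd₂ hl₂] at hf12
      exact sup_sdiff_injOn u v ⟨hd₁, hl₁⟩ ⟨hd₂, hl₂⟩ hf12

/-- Compressing two families along OPPOSITE pairs (`s` along `u,v`, `t` along `v,u`, with `u, v` disjoint) does not increase the number
of common members.  Injection: a common member `a` of the compressed families is sent to itself if it lies in `s ∩ t`, to `(a ⊔ v) \ u` if
it is new in `𝓒 u v s`, and to `(a ⊔ u) \ v` if it is new in `𝓒 v u t`; in the last two cases `a` is recovered as a compression of its image.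
[gen 20, Lemma 1(a)] -/
theorem card_compression_inter_compression_swap_le (huv : Disjoint u v) (s t : Finset α) :
    #(𝓒 u v s ∩ 𝓒 v u t) ≤ #(s ∩ t) := by
  classical
  let g : α → α := fun a =>
    if a ∈ s ∧ a ∈ t then a else if a ∉ s then (a ⊔ v) \ u else (a ⊔ u) \ v
  -- degenerate case `u = v = ⊥`: both compressions are the identity
  have degen : u = ⊥ → v = ⊥ → #(𝓒 u v s ∩ 𝓒 v u t) ≤ #(s ∩ t) := by
    rintro rfl rfl; rw [UV.compression_self, UV.compression_self]
  by_cases hbot : u = ⊥ ∧ v = ⊥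
  · exact degen hbot.1 hbot.2
  -- the specification of `g` on the three regions
  have spec : ∀ a, a ∈ 𝓒 u v s → a ∈ 𝓒 v u t → g a ∈ s ∧ g a ∈ t ∧
      ((a ∈ s ∧ a ∈ t ∧ g a = a) ∨ (a ∉ s ∧ UV.compress u v (g a) = a ∧ v ≤ g a ∧ Disjoint u (g a))
        ∨ (a ∉ t ∧ UV.compress v u (g a) = a ∧ Disjoint v (g a) ∧ u ≤ g a)) := by
    intro a has hat
    by_cases h : a ∈ s ∧ a ∈ t
    · have hga : g a = a := by simp only [g, if_pos h]
      rw [hga]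
      exact ⟨h.1, h.2, Or.inl ⟨h.1, h.2, rfl⟩⟩
    by_cases hs : a ∉ s
    · have hga : g a = (a ⊔ v) \ u := by simp only [g, if_neg h, if_pos hs]
      rw [hga]
      have hua : u ≤ a := UV.le_of_mem_compression_of_notMem has hs
      have hva : Disjoint v a := UV.disjoint_of_mem_compression_of_notMem has hs
      refine ⟨UV.sup_sdiff_mem_of_mem_compression_of_notMem has hs, ?_,
        Or.inr (Or.inl ⟨hs, UV.compress_of_disjoint_of_le' hva hua, le_sdiff.2 ⟨le_sup_right, huv.symm⟩,
          disjoint_sdiff_self_right⟩)⟩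
      rw [UV.mem_compression] at hat
      rcases hat with ⟨_, hct⟩ | ⟨hnt, b, hb, hba⟩
      · rwa [UV.compress_of_disjoint_of_le hva hua] at hct
      · exfalso
        unfold UV.compress at hba
        split_ifs at hba with hc
        · have hv : v = ⊥ := by
            have hvle : v ≤ a := by
              rw [← hba, le_sdiff]; exact ⟨le_sup_right, huv.symm⟩
            exact disjoint_self.1 (hva.mono_right hvle)
          have hu : u = ⊥ := by
            have hd : Disjoint u a := by rw [← hba]; exact disjoint_sdiff_self_right
            exact disjoint_self.1 (hd.mono_right hua)
          exact hbot ⟨hu, hv⟩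
        · exact hnt (hba ▸ hb)
    · have has' : a ∈ s := of_not_not hs
      have hat' : a ∉ t := fun h' => h ⟨has', h'⟩
      have hga : g a = (a ⊔ u) \ v := by simp only [g, if_neg h, if_neg hs]
      rw [hga]
      have hva : v ≤ a := UV.le_of_mem_compression_of_notMem hat hat'
      have hua : Disjoint u a := UV.disjoint_of_mem_compression_of_notMem hat hat'
      refine ⟨?_, UV.sup_sdiff_mem_of_mem_compression_of_notMem hat hat',
        Or.inr (Or.inr ⟨hat', UV.compress_of_disjoint_of_le' hua hva, disjoint_sdiff_self_right,
          le_sdiff.2 ⟨le_sup_right, huv⟩⟩)⟩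
      have hcs := compress_mem_of_mem_of_mem_compression has' has
      rwa [UV.compress_of_disjoint_of_le hua hva] at hcs
  refine card_le_card_of_injOn g ?_ ?_
  · intro a ha
    rw [mem_coe, mem_inter] at ha
    obtain ⟨h1, h2, -⟩ := spec a ha.1 ha.2
    exact mem_coe.2 (mem_inter.2 ⟨h1, h2⟩)
  · intro a₁ ha₁ a₂ ha₂ hg
    rw [mem_coe, mem_inter] at ha₁ ha₂
    obtain ⟨hg₁s, hg₁t, c₁⟩ := spec a₁ ha₁.1 ha₁.2
    obtain ⟨hg₂s, hg₂t, c₂⟩ := spec a₂ ha₂.1 ha₂.2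
    -- useful: if `g aᵢ ∈ s ∩ t` lies in `𝓒 u v s`, its `u,v`-compression is in `s`; same for `t` with `v,u`.
    rcases c₁ with ⟨h₁s, h₁t, e₁⟩ | ⟨h₁s, e₁, hv₁, hdu₁⟩ | ⟨h₁t, e₁, hd₁, hu₁⟩
    · rcases c₂ with ⟨h₂s, h₂t, e₂⟩ | ⟨h₂s, e₂, hv₂, hdu₂⟩ | ⟨h₂t, e₂, hd₂, hu₂⟩
      · rw [← e₁, ← e₂]; exact hg
      · -- g a₁ = a₁ ∈ s ∩ t and compress u v (g a₂) = a₂ ∉ s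
        exfalso; apply h₂s
        rw [← e₂, ← hg, e₁]
        exact compress_mem_of_mem_of_mem_compression h₁s ha₁.1
      · exfalso; apply h₂t
        rw [← e₂, ← hg, e₁]
        exact compress_mem_of_mem_of_mem_compression h₁t ha₁.2
    · rcases c₂ with ⟨h₂s, h₂t, e₂⟩ | ⟨h₂s, e₂, hv₂, hdu₂⟩ | ⟨h₂t, e₂, hd₂, hu₂⟩
      · exfalso; apply h₁s
        rw [← e₁, hg, e₂]
        exact compress_mem_of_mem_of_mem_compression h₂s ha₂.1
      · rw [← e₁, ← e₂, hg]
      · -- `v ≤ g a₁ = g a₂ ⊥ v` forces `v = ⊥`, and `u ≤ g a₂ = g a₁ ⊥ u` forces `u = ⊥`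
        exfalso
        have hv : v = ⊥ := disjoint_self.1 (hd₂.mono_right (hg ▸ hv₁))
        have hu : u = ⊥ := disjoint_self.1 (hdu₁.mono_right (hg.symm ▸ hu₂))
        exact hbot ⟨hu, hv⟩
    · rcases c₂ with ⟨h₂s, h₂t, e₂⟩ | ⟨h₂s, e₂, hv₂, hdu₂⟩ | ⟨h₂t, e₂, hd₂, hu₂⟩
      · exfalso; apply h₁t
        rw [← e₁, hg, e₂]
        exact compress_mem_of_mem_of_mem_compression h₂t ha₂.2
      · exfalso
        have hv : v = ⊥ := disjoint_self.1 (hd₁.mono_right (hg.symm ▸ hv₂))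
        have hu : u = ⊥ := disjoint_self.1 (hdu₂.mono_right (hg ▸ hu₁))
        exact hbot ⟨hu, hv⟩
      · rw [← e₁, ← e₂, hg]

/-- Compression commutes with filtering by a predicate that is invariant under single-element compression. [folklore] -/
theorem compression_filter (u v : α) (s : Finset α) (P : α → Prop) [DecidablePred P]
    (hP : ∀ a, P (UV.compress u v a) ↔ P a) : 𝓒 u v (s.filter P) = (𝓒 u v s).filter P := by
  ext a
  simp only [UV.mem_compression, mem_filter]
  constructor
  · rintro (⟨⟨has, hPa⟩, hcs, -⟩ | ⟨hn, b, ⟨hb, hPb⟩, hba⟩)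
    · exact ⟨Or.inl ⟨has, hcs⟩, hPa⟩
    · have hPa : P a := by rw [← hba]; exact (hP b).2 hPb
      exact ⟨Or.inr ⟨fun has => hn ⟨has, hPa⟩, b, hb, hba⟩, hPa⟩
  · rintro ⟨⟨has, hcs⟩ | ⟨hn, b, hb, hba⟩, hPa⟩
    · exact Or.inl ⟨⟨has, hPa⟩, hcs, (hP a).2 hPa⟩
    · refine Or.inr ⟨fun h => hn h.1, b, ⟨hb, ?_⟩, hba⟩
      rw [← hP b, hba]; exact hPa

end GBA

section BA

variable {α : Type*} [BooleanAlgebra α] [DecidableRel (@Disjoint α _ _)] [DecidableLE α]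
  [DecidableEq α] {u v : α}

omit [DecidableEq α] in
/-- The complement of a `u,v`-compression is the `v,u`-compression of the complement (`u, v` disjoint). [gen 20, Lemma 1(c)] -/
theorem compl_compress (huv : Disjoint u v) (a : α) : (UV.compress u v a)ᶜ = UV.compress v u aᶜ := by
  have hiff : (Disjoint u a ∧ v ≤ a) ↔ (Disjoint v aᶜ ∧ u ≤ aᶜ) := by
    rw [disjoint_compl_right_iff, le_compl_iff_disjoint_right, and_comm]
  unfold UV.compress
  by_cases h : Disjoint u a ∧ v ≤ a
  · have hvu : v ⊓ uᶜ = v := inf_eq_left.2 huv.symm.le_compl_right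
    rw [if_pos h, if_pos (hiff.1 h), sdiff_eq, sdiff_eq, compl_inf, compl_sup, compl_compl, inf_sup_right, hvu]
  · rw [if_neg h, if_neg (fun h' => h (hiff.2 h'))]

/-- Complements turn the `v,u`-compression of a family into the `u,v`-compression of the complemented family. [gen 20, Lemma 1(c)] -/
theorem compls_compression_swap (huv : Disjoint u v) (t : Finset α) : (𝓒 v u t)ᶜˢ = 𝓒 u v tᶜˢ := by
  ext a
  rw [mem_compls, UV.mem_compression, UV.mem_compression, mem_compls, mem_compls, compl_compress huv a]
  have key : (∃ b ∈ t, UV.compress v u b = aᶜ) ↔ ∃ b ∈ tᶜˢ, UV.compress u v b = a := by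
    constructor
    · rintro ⟨b, hb, hba⟩
      refine ⟨bᶜ, by rwa [mem_compls, compl_compl], ?_⟩
      apply compl_injective
      rw [compl_compress huv, compl_compl, hba]
    · rintro ⟨b, hb, hba⟩
      refine ⟨bᶜ, mem_compls.1 hb, ?_⟩
      rw [← compl_compress huv, hba]
  rw [key]

end BA

section AntiBand

variable {β : Type*} [DecidableEq β] [Fintype β] {u v : Finset β}

/-- Complementation commutes with a complement-invariant filter on a family of finsets. [folklore] -/
theorem compls_filter (V : Finset (Finset β)) (P : Finset β → Prop) [DecidablePred P]
    (hP : ∀ a, P aᶜ ↔ P a) : (V.filter P)ᶜˢ = Vᶜˢ.filter P := by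
  ext a
  rw [mem_compls, mem_filter, mem_filter, mem_compls, hP]

/-- **Opposite compressions do not increase the anti-band functional** (gen 20, Lemma 1).  For disjoint `u, v` of equal size and any two
families `W, V` of finsets, writing `outer s :↔ #s < l ∨ #sᶜ < l`,
`#{s ∈ 𝓒 u v W ∩ 𝓒 v u V | outer s} − #{s ∈ 𝓒 u v W ∩ (𝓒 v u V)ᶜˢ | outer s} ≤ #{s ∈ W ∩ V | outer s} − #{s ∈ W ∩ Vᶜˢ | outer s}`.
With `u = {i}`, `v = {j}` (the `ij`-shifts, which preserve up-sets) this reduces the anti-band inequality (AB_l) to left-shifted `W` against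
right-shifted `V`. [gen 20, FINDING-SHIFTING-AB-g20.md §1] -/
theorem antiBand_compression_swap_le (huv : Disjoint u v) (hcard : #u = #v) (l : ℕ) (W V : Finset (Finset β)) :
    (#((𝓒 u v W ∩ 𝓒 v u V).filter fun s => #s < l ∨ #sᶜ < l) : ℤ)
        - #((𝓒 u v W ∩ (𝓒 v u V)ᶜˢ).filter fun s => #s < l ∨ #sᶜ < l)
      ≤ (#((W ∩ V).filter fun s => #s < l ∨ #sᶜ < l) : ℤ) - #((W ∩ Vᶜˢ).filter fun s => #s < l ∨ #sᶜ < l) := by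
  classical
  set P : Finset β → Prop := fun s => #s < l ∨ #sᶜ < l with hPdef
  have hPcompl : ∀ a : Finset β, P aᶜ ↔ P a := by
    intro a; simp only [hPdef, compl_compl]; exact or_comm
  have hPuv : ∀ a : Finset β, P (UV.compress u v a) ↔ P a := by
    intro a; simp only [hPdef, card_compl, UV.card_compress hcard]
  have hPvu : ∀ a : Finset β, P (UV.compress v u a) ↔ P a := by
    intro a; simp only [hPdef, card_compl, UV.card_compress hcard.symm]
  have e1 : (𝓒 u v W ∩ 𝓒 v u V).filter P = 𝓒 u v (W.filter P) ∩ 𝓒 v u (V.filter P) := by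
    rw [filter_inter_distrib, compression_filter u v W P hPuv, compression_filter v u V P hPvu]
  have e2 : (𝓒 u v W ∩ (𝓒 v u V)ᶜˢ).filter P = 𝓒 u v (W.filter P) ∩ 𝓒 u v ((V.filter P)ᶜˢ) := by
    rw [filter_inter_distrib, compression_filter u v W P hPuv, ← compls_filter _ P hPcompl,
      ← compression_filter v u V P hPvu, compls_compression_swap huv]
  have e3 : (W ∩ V).filter P = W.filter P ∩ V.filter P := by rw [filter_inter_distrib]
  have e4 : (W ∩ Vᶜˢ).filter P = W.filter P ∩ (V.filter P)ᶜˢ := by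
    rw [filter_inter_distrib, compls_filter _ P hPcompl]
  rw [e1, e2, e3, e4]
  have h1 := card_compression_inter_compression_swap_le huv (W.filter P) (V.filter P)
  have h2 := card_inter_le_card_compression_inter u v (W.filter P) ((V.filter P)ᶜˢ)
  omega

end AntiBand


end Summit.CriticalPhenomena.PercolationContinuityZ3.Theorems.AntiBandShift
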